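import Mathlib
import Summits.Ventures.PercRepro2.UniversalAlignedSer
import Summits.Ventures.PercRepro2.UniversalAlignedPar

/-! # (UH*) holds on every series–parallel network
(seat mine-b, cell pub-perc-repro2; MINE-B.md §29)

The level-aligned package `PackageL` (UniversalAlignedDefs.lean) is carried by the three atoms of the cell's
grammar (a free edge: every slot and every level relay goes to the red state; a pinned or absent edge: no
source, every relay the identity) and is closed under series composition (`PackageL.ser`, coordinatewise)
and parallel composition (`PackageL.par`, the three-family rule).  So every term carries one
(`SP.packageL`), and its first component is the universal level-conditioned Hall assignment:

  `SP.universal_all : ∀ s : SP, Universal s.rLab s.bLab`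

— for every series–parallel two-terminal network, every configuration with red flow `0` and blue flow
`a ≥ 1` owns `a` private configurations below it with red flow exactly `1` and blue flow `≥ a − 1`,
in one injective assignment for all sources and all levels at once (MINE-B.md §18.1(a), row 2′DOM2 cell 6).
Previously in the tree: the good networks (`SP.universal_of_good`), the double bundles, the series of
bundles, the towers `X ∧ B_K` over computed packages, and every network with ≤ 10 edges by table
certificates (`SP.universal_le10`). -/

namespace Summit.Ventures.PercRepro2.V2Closure

open Summit.Ventures.PercRepro2.UHClosure

/-! ### The atoms -/

/-- the level-aligned package of the free edge: everything goes to the red state `false` -/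
def packageL_free : PackageL (fun c : Bool => if c then 0 else 1) (fun c : Bool => if c then 1 else 0) where
  f := fun _ => false
  f_inj := by
    rintro ⟨⟨⟨c, hc⟩, ⟨i, hi⟩⟩, h⟩ ⟨⟨⟨c', hc'⟩, ⟨i', hi'⟩⟩, h'⟩ -
    cases c
    · exact absurd hc.1.1 (by decide)
    · cases c'
      · exact absurd hc'.1.1 (by decide)
      · have : i = 0 := by simp at h; omega
        have : i' = 0 := by simp at h'; omega
        subst_vars; rfl
  f_spec := by
    rintro ⟨⟨⟨c, hc⟩, ⟨i, hi⟩⟩, h⟩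
    refine ⟨Bool.false_le _, by decide, ?_⟩
    cases c <;> simp
  α := fun _ _ => false
  α_inj := by
    intro k z z' hz hz' _
    cases z <;> cases z'
    · rfl
    · exact absurd hz (by simp)
    · exact absurd hz' (by simp)
    · rfl
  α_spec := by
    intro k z _
    refine ⟨Bool.false_le _, by decide, ?_⟩
    cases z <;> decide
  α_avoid := by
    intro k z hz p hp _
    cases z
    · exact absurd hz (by simp)
    · simp at hz; omega
  α_src := fun _ _ => rfl
  β := fun _ _ => false
  β_inj := by
    intro k u u' hu hk _ _ _
    cases u
    · exact absurd hk (by simp)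
    · exact absurd hu (by simp)
  β_spec := by
    intro k u hu hk
    cases u
    · exact absurd hk (by simp)
    · exact absurd hu (by simp)
  β_avoid := by
    intro k u hu hk _ _ _
    cases u
    · exact absurd hk (by simp)
    · exact absurd hu (by simp)

/-- the level-aligned package of the pinned edge: no source, every relay the identity -/
def packageL_pin : PackageL (fun _ : Unit => 1) (fun _ : Unit => 1) where
  f := fun _ => ()
  f_inj := fun p _ _ => absurd p.1.1.2.1.1 Nat.one_ne_zero
  f_spec := fun p => absurd p.1.1.2.1.1 Nat.one_ne_zero
  α := fun _ z => z
  α_inj := fun _ _ _ _ _ h => h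
  α_spec := fun _ _ _ => ⟨le_rfl, le_rfl, by show 1 ≤ 1 + 1; omega⟩
  α_avoid := fun _ _ _ p _ => absurd p.1.1.2.1.1 Nat.one_ne_zero
  α_src := fun p _ => absurd p.1.1.2.1.1 Nat.one_ne_zero
  β := fun _ u => u
  β_inj := fun _ _ _ _ _ _ _ h => h
  β_spec := fun _ _ _ _ => ⟨le_rfl, le_rfl, by show 1 ≤ 1 + 1; omega⟩
  β_avoid := fun _ _ _ _ p _ => absurd p.1.1.2.1.1 Nat.one_ne_zero

/-- the level-aligned package of the absent edge: no blue-positive element at all -/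
def packageL_absent : PackageL (fun _ : Unit => 0) (fun _ : Unit => 0) where
  f := fun _ => ()
  f_inj := fun p _ _ => absurd p.1.1.2.1.2 (Nat.not_succ_le_zero 0)
  f_spec := fun p => absurd p.1.1.2.1.2 (Nat.not_succ_le_zero 0)
  α := fun _ z => z
  α_inj := fun _ _ _ _ _ h => h
  α_spec := fun _ _ hz => absurd hz (Nat.not_lt_zero _)
  α_avoid := fun _ _ hz _ _ => absurd hz (Nat.not_lt_zero _)
  α_src := fun p _ => absurd p.1.1.2.1.2 (Nat.not_succ_le_zero 0)
  β := fun _ u => u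
  β_inj := fun _ _ _ _ _ _ _ h => h
  β_spec := fun _ _ _ hz => absurd hz (Nat.not_lt_zero _)
  β_avoid := fun _ _ _ hz _ _ => absurd hz (Nat.not_lt_zero _)

/-! ### Every term -/

/-- **every series–parallel term carries a level-aligned package** -/
noncomputable def SP.packageL : ∀ s : SP, PackageL s.rLab s.bLab
  | .free => packageL_free
  | .pin => packageL_pin
  | .absent => packageL_absent
  | .ser s t => (SP.packageL s).ser (SP.packageL t)
  | .par s t => (SP.packageL s).par (SP.packageL t)

/-- **(UH*) ON EVERY SERIES–PARALLEL NETWORK** (MINE-B.md §18.1(a), row 2′DOM2 cell 6): for every term of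
the cell's grammar, every configuration with red flow `0` and blue flow `a ≥ 1` owns `a` private
configurations below it with red flow `1` and blue flow `≥ a − 1`, in one injective assignment -/
theorem SP.universal_all (s : SP) : Universal s.rLab s.bLab := (SP.packageL s).universal

end Summit.Ventures.PercRepro2.V2Closure
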